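import Summits.MatrixMultiplication.MatrixMultiplication.Theorems.FarEdgeDescentIsolatedChain
import Summits.MatrixMultiplication.MatrixMultiplication.Theorems.FarEdgeDescentImprovableRate
import HarnessLib

/-!
# Far-edge descent, kernel XXXII-D: the UNCONDITIONAL rate `0.70951…⁻` at the far edge

Route `FarEdgeDescent`, special leaf `FiniteSaturation` (stmt-MatrixMultiplication-23739): helper
kernel, THESES-FREE and def-free.  This file closes the improvable programme of kernels XXXI-A/B and
XXXII-A/B/C: it realises Schönhage's `E₃`, i.e. the outer product `⟨3,1,3⟩` computed by `3² + 1 = 10`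
products of which one is "wasted" (the triad `1 ⊗ (∑xᵢ) ⊗ (∑yⱼ)` with weight `−1` makes the
weighted inner products `∑_s d_s u_s(b) v_s(c)` vanish identically — Schönhage 1981, §5; Knuth TAOCP 2,
§4.6.4 Ex. 67(g)), re-anchors it COST-FREE as `⟨1,4,1⟩ ⊕ ⟨3,1,3⟩` with an ISOLATED anchor
(kernel XXXII-A `isolated_reanchor`), feeds it to the certified improvable squaring tower
(kernel XXXII-C `isolatedTowerChain`: `r₀ = 10`, `Q₀ = 4`, `L₀ = 3`, `G₀(s,t) = 3^s`) and reads off,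
by kernel XXXI-B (`rateBeyond_of_improvableChain`, initial deviation `(3^s − 3)/10 ≥ (3/10)(s−1)`):

  `RateBeyond θ` for EVERY `θ < κ/(1−κ) = log(4/3)/log(3/2) = 0.70951…`, `κ = log₂(4/3)`,

over every field — unconditionally (`rateBeyond_isolatedTower`); certified rational floors `7/10`
and `39/55 = 0.70909…` (`(4/3)^94 > 2^39`).  This supersedes the crude-tower rate `δ* = 0.448608…⁻`
of kernel XXX-B (`FarEdgeDescentTowerRate`) as the lineage's rate of record for the special leaf:
`ω(1,k,1) − (k+1) ≤ C·k^{−δ}` for some `δ > 0.709`.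

* §1 `outer_improvable` — `⟨n,1,n⟩` by `n² + 1` products with weights `d = (1,…,1,−1)` and
  `∑_s d_s u_s(b) v_s(c) = 0`; `base_isolated` — the isolated-anchor realization of
  `⟨1,4,1⟩ ⊕ ⟨3,1,3⟩` of length `10`.
* §2 `three_mul_le_rpow` (`3s ≤ 3^s`, `s ≥ 1`), `improvableOrder_eq` (`κ/(1−κ) = log(4/3)/log(3/2)`),
  `improvableOrder_gt_39_55`.
* §3 `rateBeyond_isolatedTower` and the floors `rateBeyond_of_le_39_55`, `rateBeyond_seven_tenths`.

References: Schönhage 1981, §5; Pan 1984 (LNCS 179) §§16–17 (Thm. 17.1: `ω ≤ 2.5218` from this very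
tower with finer bookkeeping); Stothers 2010, Thm. 8; Knuth TAOCP 2, §4.6.4 Ex. 67(g),(h);
Lotti–Romani 1983, Prop. 4.1; Coppersmith–Winograd 1982.
Tags: `FiniteSaturation` (h₁) NEC · WEAKER · ATTACKED (rate `0.70951…⁻`, unconditional).
-/

set_option linter.dupNamespace false

noncomputable section

open scoped BigOperators Polynomial
open Polynomial

namespace Summit.MatrixMultiplication.MatrixMultiplication.Theorems.FarEdgeDescentIsolatedTower

open Literature.Computability.AlgebraicComplexity
open Summit.MatrixMultiplication.MatrixMultiplication.Theorems.FarEdgeDescentIsolatedStep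
open Summit.MatrixMultiplication.MatrixMultiplication.Theorems.FarEdgeDescentIsolatedChain
open Summit.MatrixMultiplication.MatrixMultiplication.Theorems.FarEdgeDescentImprovableRate

variable (K : Type) [Field K]

/-! ## §1 The base: Schönhage's `E₃` with an isolated anchor -/

/-- The entries of the one-block direct sum `⟨n,1,n⟩` (an outer product `xᵢyₖ`). [folklore] -/
theorem outer_entry (n : ℕ) (a : Σ _ : Fin 1, Fin n × Fin n) (b : Σ _ : Fin 1, Fin n × Fin 1)
    (c : Σ _ : Fin 1, Fin 1 × Fin n) :
    matMulDirectSum K (fun _ : Fin 1 => n) (fun _ => 1) (fun _ => n) a b c =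
      if a.2.1 = b.2.1 ∧ a.2.2 = c.2.2 then 1 else 0 := by
  obtain ⟨ia, i, k⟩ := a
  obtain ⟨ib, i', z⟩ := b
  obtain ⟨ic, z', k'⟩ := c
  obtain rfl : ia = ib := Subsingleton.elim _ _
  obtain rfl : ia = ic := Subsingleton.elim _ _
  obtain rfl : z = z' := Subsingleton.elim _ _
  simp [matMulDirectSum, Fin.ext_iff]

/-- **`⟨n,1,n⟩` by `n² + 1` products, improvably** (Schönhage 1981, §5; Knuth TAOCP 2, §4.6.4
Ex. 67(g)): the `n²` trivial triads `e_{ik} ⊗ xᵢ ⊗ yₖ` plus the wasted triad `0 ⊗ (∑ᵢxᵢ) ⊗ (∑ₖyₖ)`,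
with weights `dₛ = 1` (`s ≤ n²`) and `−1` (the wasted one): an exact (order-`0`) realization whose
weighted inner products `∑ₛ dₛ uₛ(b) vₛ(c) = 1 − 1` vanish for ALL inputs `b, c`.
[cite: Schonhage1981, §5] [cite: KnuthTAOCP2, §4.6.4, Ex. 67(g)] -/
theorem outer_improvable (n : ℕ) :
    ∃ (w : Fin (n * n + 1) → (Σ _ : Fin 1, Fin n × Fin n) → K[X])
      (u : Fin (n * n + 1) → (Σ _ : Fin 1, Fin n × Fin 1) → K[X])
      (v : Fin (n * n + 1) → (Σ _ : Fin 1, Fin 1 × Fin n) → K[X]) (d : Fin (n * n + 1) → K[X]),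
      IsApproxDecomposition 0 (matMulDirectSum K (fun _ : Fin 1 => n) (fun _ => 1) (fun _ => n))
        w u v ∧ (∀ s, d s ≠ 0) ∧ ∀ b c, ∑ s, d s * u s b * v s c = 0 := by
  classical
  have hcard : Fintype.card (Fin n × Fin n ⊕ Unit) = n * n + 1 := by simp
  let e : Fin (n * n + 1) ≃ (Fin n × Fin n ⊕ Unit) := (Fintype.equivFinOfCardEq hcard).symm
  -- scalar factors and weights on the index set `Fin n × Fin n ⊕ Unit`
  let W : (Fin n × Fin n ⊕ Unit) → (Σ _ : Fin 1, Fin n × Fin n) → K :=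
    fun x a => Sum.elim (fun ik => if a.2 = ik then (1 : K) else 0) (fun _ => 0) x
  let U : (Fin n × Fin n ⊕ Unit) → (Σ _ : Fin 1, Fin n × Fin 1) → K :=
    fun x b => Sum.elim (fun ik => if ik.1 = b.2.1 then (1 : K) else 0) (fun _ => 1) x
  let V : (Fin n × Fin n ⊕ Unit) → (Σ _ : Fin 1, Fin 1 × Fin n) → K :=
    fun x c => Sum.elim (fun ik => if ik.2 = c.2.2 then (1 : K) else 0) (fun _ => 1) x
  let D : (Fin n × Fin n ⊕ Unit) → K := fun x => Sum.elim (fun _ => (1 : K)) (fun _ => -1) x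
  refine ⟨fun s a => C (W (e s) a), fun s b => C (U (e s) b), fun s c => C (V (e s) c),
    fun s => C (D (e s)), ?_, ?_, ?_⟩
  · intro a b c j hj
    obtain rfl : j = 0 := Nat.le_zero.1 hj
    simp only [← Polynomial.C_mul, if_true, Polynomial.finsetSum_coeff, Polynomial.coeff_C_zero]
    rw [show (∑ s, W (e s) a * U (e s) b * V (e s) c) = ∑ x, W x a * U x b * V x c from
      Equiv.sum_comp e (fun x => W x a * U x b * V x c), Fintype.sum_sum_type, outer_entry]
    simp only [W, U, V, Sum.elim_inl, Sum.elim_inr, zero_mul, Finset.sum_const_zero, add_zero]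
    rw [Finset.sum_eq_single a.2 (fun ik _ hik => by rw [if_neg (Ne.symm hik), zero_mul, zero_mul])
      (fun h => absurd (Finset.mem_univ _) h), if_pos rfl, one_mul]
    by_cases h1 : a.2.1 = b.2.1 <;> by_cases h2 : a.2.2 = c.2.2 <;> simp [h1, h2]
  · intro s
    rw [Ne, Polynomial.C_eq_zero]
    simp only [D]
    cases e s <;> simp
  · intro b c
    simp only [← Polynomial.C_mul]
    rw [← map_sum, Polynomial.C_eq_zero,
      show (∑ s, D (e s) * U (e s) b * V (e s) c) = ∑ x, D x * U x b * V x c from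
        Equiv.sum_comp e (fun x => D x * U x b * V x c), Fintype.sum_sum_type]
    simp only [D, U, V, Sum.elim_inl, Sum.elim_inr, one_mul, mul_one, Finset.univ_unique,
      Finset.sum_singleton]
    rw [Finset.sum_eq_single (b.2.1, c.2.2) (fun ik _ hik => ?_)
      (fun h => absurd (Finset.mem_univ _) h)]
    · simp
    · obtain ⟨x, y⟩ := ik
      by_cases hx : x = b.2.1
      · subst hx
        have hy : y ≠ c.2.2 := fun hy => hik (by rw [hy])
        simp [hy]
      · simp [hx]

/-- **Schönhage's `E₃` with an isolated anchor**: `⟨1,4,1⟩ ⊕ ⟨3,1,3⟩` has an approximate realization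
of length `10 = 4 + 2·3` whose weighted inner products vanish off the anchor inputs (kernel XXXII-A
`isolated_reanchor` applied to `outer_improvable 3`; `4 + 3 + 3 ≤ 10`).
[cite: Schonhage1981, §5] [cite: CoppersmithWinograd1982, §3] [cite: KnuthTAOCP2, §4.6.4, Ex. 67(g)] -/
theorem base_isolated :
    ∃ (H : ℕ) (u : Fin (3 * 3 + 1) → _ → K[X]) (v : Fin (3 * 3 + 1) → _ → K[X])
      (w : Fin (3 * 3 + 1) → _ → K[X]) (d : Fin (3 * 3 + 1) → K[X]),
      IsApproxDecomposition H (matMulDirectSum K (Fin.cons 1 (fun _ : Fin 1 => 3))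
        (Fin.cons 4 (fun _ : Fin 1 => 1)) (Fin.cons 1 (fun _ : Fin 1 => 3))) u v w ∧
      (∀ s, d s ≠ 0) ∧ ∀ b c, ¬ (b.1 = 0 ∧ c.1 = 0) → ∑ s, d s * v s b * w s c = 0 := by
  obtain ⟨w, u, v, d, hreal, hd, himp⟩ := outer_improvable K 3
  exact isolated_reanchor (fun _ : Fin 1 => 3) (fun _ : Fin 1 => 1) (fun _ : Fin 1 => 3) hreal d hd
    himp (q := 4) (by simp)

/-! ## §2 Numerics -/

/-- `3s ≤ 3^s` for `s ≥ 1` (`3^{s−1} = e^{(s−1)log 3} ≥ 1 + (s−1)log 3 ≥ s`, `log 3 ≥ 1`). [folklore] -/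
theorem three_mul_le_rpow {s : ℝ} (hs : 1 ≤ s) : 3 * s ≤ (3 : ℝ) ^ s := by
  have hlog : 1 ≤ Real.log 3 := by
    rw [Real.le_log_iff_exp_le (by norm_num)]
    have h := Real.exp_one_lt_d9
    norm_num at h
    linarith
  have h1 : s ≤ (3 : ℝ) ^ (s - 1) := by
    rw [Real.rpow_def_of_pos (by norm_num)]
    have h2 := Real.add_one_le_exp (Real.log 3 * (s - 1))
    have h3 : 1 * (s - 1) ≤ Real.log 3 * (s - 1) :=
      mul_le_mul_of_nonneg_right hlog (sub_nonneg.2 hs)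
    linarith
  calc 3 * s ≤ 3 * (3 : ℝ) ^ (s - 1) := by linarith
    _ = (3 : ℝ) ^ s := by
      rw [mul_comm, ← Real.rpow_add_one (by norm_num : (3 : ℝ) ≠ 0), sub_add_cancel]

/-- **The improvable order in closed form**: `κ/(1−κ) = log(4/3)/log(3/2)` (`= 0.70951…`),
`κ = log₂(4/3)`. [folklore] -/
theorem improvableOrder_eq :
    Real.logb 2 ((4 : ℝ) / 3) / (1 - Real.logb 2 ((4 : ℝ) / 3)) =
      Real.log ((4 : ℝ) / 3) / Real.log ((3 : ℝ) / 2) := by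
  have h2 : Real.log 2 ≠ 0 := (Real.log_pos (by norm_num)).ne'
  have h32 : Real.log ((3 : ℝ) / 2) = Real.log 2 - Real.log ((4 : ℝ) / 3) := by
    rw [← Real.log_div (by norm_num) (by norm_num)]
    norm_num
  have h32' : Real.log ((3 : ℝ) / 2) ≠ 0 := (Real.log_pos (by norm_num)).ne'
  rw [Real.logb, h32]
  rw [h32] at h32'
  field_simp

/-- **The improvable order exceeds `39/55 = 0.70909…`**: `κ > 39/94` because `(4/3)^94 > 2^39`.
[folklore] -/
theorem improvableOrder_gt_39_55 :
    (39 : ℝ) / 55 < Real.logb 2 ((4 : ℝ) / 3) / (1 - Real.logb 2 ((4 : ℝ) / 3)) := by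
  have h1 : Real.log ((2 : ℝ) ^ 39) < Real.log (((4 : ℝ) / 3) ^ 94) :=
    Real.log_lt_log (by positivity) (by norm_num)
  rw [Real.log_pow, Real.log_pow] at h1
  push_cast at h1
  have h2 : 0 < Real.log 2 := Real.log_pos (by norm_num)
  have hκ : (39 : ℝ) / 94 < Real.logb 2 ((4 : ℝ) / 3) := by
    rw [Real.logb, lt_div_iff₀ h2]
    linarith
  have hκ1 := improvableKappa_pos_lt_one.2
  rw [lt_div_iff₀ (by linarith)]
  linarith

/-! ## §3 The unconditional rate -/

/-- **THE FAR-EDGE RATE `0.70951…⁻`, UNCONDITIONALLY** (Pan 1984 §§16–17 / Stothers 2010 Thm. 8,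
arithmetised): over every field `K`, for every `θ < κ/(1−κ) = log(4/3)/log(3/2) = 0.70951…`
(`κ = log₂(4/3)`) there are `δ > θ` and `C` with

  `ω_K(1,k,1) − (k+1) ≤ C · k^{−δ}`  for all `k ≥ 1`.

Proof: Schönhage's `E₃` with an isolated anchor (`base_isolated`: `r₀ = 10`, `Q₀ = 4`, `L₀ = 3`,
`G₀(s,t) = 3^s`) starts the certified improvable squaring tower (`isolatedTowerChain`); its initial
deviation on `1 ≤ s ≤ 2` is `(3^s − 3)/10 ≥ (3/10)(s − 1)` (`three_mul_le_rpow`); kernel XXXI-B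
(`rateBeyond_of_improvableChain`) converts the chain into the rate.  Supersedes the crude rate
`0.448608…⁻` of kernel XXX-B. [cite: Pan1984, §16 Props. 16.2–16.5, §17 Thm. 17.1]
[cite: Stothers2010, Thm. 8] [cite: Schonhage1981, §5] [cite: LottiRomani1983, Prop. 4.1] -/
theorem rateBeyond_isolatedTower {θ : ℝ}
    (hθ : θ < Real.logb 2 ((4 : ℝ) / 3) / (1 - Real.logb 2 ((4 : ℝ) / 3))) :
    ∃ δ C : ℝ, θ < δ ∧ ∀ k : ℕ, 1 ≤ k →
      omegaRect K 1 k 1 - (k + 1) ≤ C * (k : ℝ) ^ (-δ) := by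
  obtain ⟨H, u, v, w, d, hreal, hd, himp⟩ := base_isolated K
  obtain ⟨r, Q, L, G, h0r, h0Q, h0L, h0G, hsum, hQ1, hL, hr, hG, hread⟩ :=
    isolatedTowerChain K (fun _ : Fin 1 => 3) (fun _ : Fin 1 => 1) (fun _ => by norm_num)
      (fun _ => le_rfl) (Q₀ := 4) (by norm_num) (by simp) ⟨u, v, w, d, hreal, hd, himp⟩
  refine rateBeyond_of_improvableChain K r Q L G ?_ hsum hQ1 ?_ hL hr ?_ hG hread
    (c := 3 / 10) (by norm_num) ?_ hθ
  · rw [h0r]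
    norm_num
  · rw [h0L, h0r]
    simp
  · intro s t
    rw [h0G]
    exact Finset.sum_nonneg fun _ _ =>
      mul_nonneg (Real.rpow_nonneg (Nat.cast_nonneg _) _) (Real.rpow_nonneg (Nat.cast_nonneg _) _)
  · intro s t _ _ hs1 _ _
    rw [h0G, h0L, h0r]
    simp only [Fin.sum_univ_one, Nat.cast_ofNat, Nat.cast_one, Real.one_rpow, mul_one]
    push_cast
    have h3 := three_mul_le_rpow hs1
    linarith

/-- **Certified floor `39/55 = 0.70909…`**: `RateBeyond θ` for every `θ ≤ 39/55`, unconditionally.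
[cite: Pan1984, Thm. 17.1] [cite: Stothers2010, Thm. 8] -/
theorem rateBeyond_of_le_39_55 {θ : ℝ} (hθ : θ ≤ 39 / 55) :
    ∃ δ C : ℝ, θ < δ ∧ ∀ k : ℕ, 1 ≤ k →
      omegaRect K 1 k 1 - (k + 1) ≤ C * (k : ℝ) ^ (-δ) :=
  rateBeyond_isolatedTower K (lt_of_le_of_lt hθ improvableOrder_gt_39_55)

/-- **Certified floor `7/10`**: `RateBeyond (7/10)` — there are `δ > 0.7` and `C` with
`ω_K(1,k,1) − (k+1) ≤ C·k^{−δ}` (`k ≥ 1`), over every field, unconditionally.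
[cite: Pan1984, Thm. 17.1] [cite: Stothers2010, Thm. 8] -/
theorem rateBeyond_seven_tenths :
    ∃ δ C : ℝ, (7 : ℝ) / 10 < δ ∧ ∀ k : ℕ, 1 ≤ k →
      omegaRect K 1 k 1 - (k + 1) ≤ C * (k : ℝ) ^ (-δ) :=
  rateBeyond_isolatedTower K improvableOrder_gt

end Summit.MatrixMultiplication.MatrixMultiplication.Theorems.FarEdgeDescentIsolatedTower

end
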